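import Summits.MatrixMultiplication.MatrixMultiplication.Theorems.FarEdgeDescentExactSteps
import Summits.MatrixMultiplication.MatrixMultiplication.Theorems.FarEdgeDescentCeilingSteps
import HarnessLib

/-!
# Far-edge descent, kernel XXXVII-C: the dictionary of the exact product step; base-fed schedules are blind

Route `FarEdgeDescent`, special leaf `FiniteSaturation` (stmt-MatrixMultiplication-23739): helper
kernel, THESES-FREE and def-free.  The tensor-number side of kernel XXXVII-B
(`FarEdgeDescentExactCeiling.exact_ceiling`): why EVERY product-and-full-reanchor step of two anchored
objects `⟨1,Q,1⟩ ⊕ legs` (budget `r = Q + 2L`, `L = ΣaB`, full virtual sum `V = Q^t + Σa^sB^t`) satisfies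
the step clause of `exactSchedule_invariant` — `λ'' = λ + λ' − 3λλ'`, `ℓ'' = ℓ + ℓ'`,
`0 ≤ F'' ≤ FF' + 2λλ'·min(1, exp(−(1−t)(ℓ''−Λ)))` (`exact_product_step`: the new anchor
`Q'' = QQ' + 2LL'` and the subadditivity of `x ↦ x^t`) — and why every base satisfies the base clause
(`block_value_le`: the census is linear in `s − 1`).  §2 (`baseFed_blind`): schedules in which every
product has a BASE parent pass at every `(s,t)` with `σ` below the base threshold (`F_B ≤ 1 − (2/3)λ_B`,
e.g. `3^s ≤ 4` for Schönhage's `E₃`), whatever `t` — they certify no rate of `e(k) → 0` at all; all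
certifying power of the toolbox sits in deep × deep products, which kernel XXXVII-B caps at `θ_S`.

References: Schönhage 1981, §5; Pan 1984 (LNCS 179) §16; Coppersmith–Winograd 1982; Alman–Li 2026,
Thm. 5.1 (the budget `Q + 2L = r`); Knuth TAOCP 2, §4.6.4 Ex. 67(g).
Tags: `FiniteSaturation` (h₁) NEC · WEAKER · ATTACKED; dictionary for the exact ceiling (XXXVII-B).
-/

set_option linter.dupNamespace false

noncomputable section

namespace Summit.MatrixMultiplication.MatrixMultiplication.Theorems.FarEdgeDescentExactDictionary

open Summit.MatrixMultiplication.MatrixMultiplication.Theorems.FarEdgeDescentAnchorTax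
open Summit.MatrixMultiplication.MatrixMultiplication.Theorems.FarEdgeDescentCeilingSteps
open Summit.MatrixMultiplication.MatrixMultiplication.Theorems.FarEdgeDescentExactSteps

/-! ## §1 The dictionary: one product-and-full-reanchor step of two anchored objects -/

/-- `x^t = x·exp(−(1−t) log x)` for `x > 0`. [folklore] -/
theorem rpow_eq_mul_exp {x t : ℝ} (hx : 0 < x) :
    x ^ t = x * Real.exp (-((1 - t) * Real.log x)) := by
  rw [Real.rpow_def_of_pos hx]
  calc Real.exp (Real.log x * t) = Real.exp (Real.log x + -((1 - t) * Real.log x)) := by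
        congr 1; ring
    _ = x * Real.exp (-((1 - t) * Real.log x)) := by rw [Real.exp_add, Real.exp_log hx]

/-- **Base census per block.**  A leg block `⟨a, B, a⟩` (`a, B ≥ 1`) has virtual value
`a^s B^t ≤ aB·(1 + (a−1)(s−1))` at every sub-tangent parameter `1 ≤ s ≤ 2`, `t ≤ 1`: the base excess
is linear in `σ = s − 1` (`rpow_le_linear` of kernel XXXIII-A), and the anchor `⟨1,Q,1⟩` has `Q^t ≤ Q`
(`x^t ≤ x^1`).  Summing over the legs of a base `E` with `r = Q + 2·ΣaB`:
`F_E = (Q^t + Σa^sB^t)/r ≤ 1 − λ_E + σ·Σ aB(a−1)/r`. [cite: Schonhage1981, §5] -/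
theorem block_value_le {a b s t : ℝ} (ha : 1 ≤ a) (hb : 1 ≤ b) (hs1 : 1 ≤ s) (hs2 : s ≤ 2)
    (ht1 : t ≤ 1) : a ^ s * b ^ t ≤ a * b * (1 + (a - 1) * (s - 1)) := by
  have h1 := rpow_le_linear ha hs1 hs2
  have h2 : b ^ t ≤ b := (Real.rpow_le_rpow_of_exponent_le hb ht1).trans_eq (Real.rpow_one b)
  have h3 : 0 ≤ a * (1 + (a - 1) * (s - 1)) := by
    have : 0 ≤ (a - 1) * (s - 1) := mul_nonneg (by linarith) (by linarith)
    nlinarith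
  calc a ^ s * b ^ t ≤ a * (1 + (a - 1) * (s - 1)) * b :=
        mul_le_mul h1 h2 (Real.rpow_nonneg (by linarith) t) h3
    _ = a * b * (1 + (a - 1) * (s - 1)) := by ring

/-- **THE EXACT PRODUCT STEP** (the dictionary behind the step clause of `FarEdgeDescentExactCeiling.exactSchedule_invariant`).
Two anchored objects `⟨1,Q,1⟩ ⊕ legs`, `⟨1,Q',1⟩ ⊕ legs'` with budgets `r = Q + 2L`, `r' = Q' + 2L'`
(`L = ΣaB` over the legs, `Q, Q', L, L' ≥ 1`) and full virtual sums `V = Q^t + G`, `V' = Q'^t + G'` at a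
sub-tangent (`0 ≤ t ≤ 1`; `G, G' ≥ 0` the legs' values).  Their product, fully re-anchored, has budget
`rr' = Q'' + 2L''` with `Q'' = QQ' + 2LL'`, legs `L'' = QL' + Q'L + LL'` — so `λ'' = λ + λ' − 3λλ'` and
`ℓ'' = ℓ + ℓ'` — and full virtual sum `V'' = Q''^t + (VV' − (QQ')^t)` with
`0 ≤ V''/(rr') ≤ FF' + 2λλ'·min(1, exp(−(1−t)(ℓ'' − Λ)))` whenever `rr' ≤ e^Λ·2LL'` (e.g.
`Λ = log(1/(2λ₀²))`): subadditivity `(QQ'+2LL')^t ≤ (QQ')^t + (2LL')^t` and `(2LL')^t = 2LL'·(2LL')^{−(1−t)}`.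
[cite: Schonhage1981, §5] [cite: Pan1984, Props. 16.2–16.5] [cite: AlmanLi2026, Thm. 5.1] -/
theorem exact_product_step {Q L Q' L' G G' t Λ : ℝ} (hQ : 1 ≤ Q) (hQ' : 1 ≤ Q') (hL : 1 ≤ L)
    (hL' : 1 ≤ L') (hG : 0 ≤ G) (hG' : 0 ≤ G') (ht0 : 0 ≤ t) (ht1 : t ≤ 1)
    (hΛ : (Q + 2 * L) * (Q' + 2 * L') ≤ Real.exp Λ * (2 * L * L')) :
    (Q + 2 * L) * (Q' + 2 * L') = (Q * Q' + 2 * L * L') + 2 * (Q * L' + Q' * L + L * L') ∧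
    (Q * L' + Q' * L + L * L') / ((Q + 2 * L) * (Q' + 2 * L')) =
      L / (Q + 2 * L) + L' / (Q' + 2 * L') - 3 * (L / (Q + 2 * L)) * (L' / (Q' + 2 * L')) ∧
    Real.log ((Q + 2 * L) * (Q' + 2 * L')) = Real.log (Q + 2 * L) + Real.log (Q' + 2 * L') ∧
    0 ≤ ((Q * Q' + 2 * L * L') ^ t + ((Q ^ t + G) * (Q' ^ t + G') - (Q * Q') ^ t)) /
        ((Q + 2 * L) * (Q' + 2 * L')) ∧
    ((Q * Q' + 2 * L * L') ^ t + ((Q ^ t + G) * (Q' ^ t + G') - (Q * Q') ^ t)) /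
        ((Q + 2 * L) * (Q' + 2 * L')) ≤
      (Q ^ t + G) / (Q + 2 * L) * ((Q' ^ t + G') / (Q' + 2 * L')) +
        2 * (L / (Q + 2 * L)) * (L' / (Q' + 2 * L')) ∧
    ((Q * Q' + 2 * L * L') ^ t + ((Q ^ t + G) * (Q' ^ t + G') - (Q * Q') ^ t)) /
        ((Q + 2 * L) * (Q' + 2 * L')) ≤
      (Q ^ t + G) / (Q + 2 * L) * ((Q' ^ t + G') / (Q' + 2 * L')) +
        2 * (L / (Q + 2 * L)) * (L' / (Q' + 2 * L')) *
          Real.exp (-((1 - t) * (Real.log ((Q + 2 * L) * (Q' + 2 * L')) - Λ))) := by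
  have hr : 0 < Q + 2 * L := by linarith
  have hr' : 0 < Q' + 2 * L' := by linarith
  have hrr : 0 < (Q + 2 * L) * (Q' + 2 * L') := mul_pos hr hr'
  have hLL1 : 1 ≤ 2 * L * L' := by nlinarith
  have hLL0 : 0 < 2 * L * L' := by linarith
  have hsub : (Q * Q' + 2 * L * L') ^ t ≤ (Q * Q') ^ t + (2 * L * L') ^ t :=
    Real.rpow_add_le_add_rpow (by positivity) hLL0.le ht0 ht1
  have hE1 : (2 * L * L') ^ t ≤ 2 * L * L' :=
    (Real.rpow_le_rpow_of_exponent_le hLL1 ht1).trans_eq (Real.rpow_one _)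
  have hE2 : (2 * L * L') ^ t ≤
      2 * L * L' * Real.exp (-((1 - t) * (Real.log ((Q + 2 * L) * (Q' + 2 * L')) - Λ))) := by
    rw [rpow_eq_mul_exp hLL0]
    apply mul_le_mul_of_nonneg_left _ hLL0.le
    apply Real.exp_le_exp.2
    have hlog : Real.log ((Q + 2 * L) * (Q' + 2 * L')) - Λ ≤ Real.log (2 * L * L') := by
      have h := Real.log_le_log hrr hΛ
      rw [Real.log_mul (Real.exp_pos Λ).ne' hLL0.ne', Real.log_exp] at h
      linarith
    have := mul_le_mul_of_nonneg_left hlog (by linarith : (0 : ℝ) ≤ 1 - t)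
    linarith
  have hV : 0 ≤ (Q ^ t + G) * (Q' ^ t + G') - (Q * Q') ^ t := by
    rw [Real.mul_rpow (by linarith) (by linarith)]
    have hQt : 0 ≤ Q ^ t := Real.rpow_nonneg (by linarith) t
    have hQt' : 0 ≤ Q' ^ t := Real.rpow_nonneg (by linarith) t
    nlinarith [mul_nonneg hQt hG', mul_nonneg hG hQt', mul_nonneg hG hG']
  refine ⟨by ring, ?_, Real.log_mul hr.ne' hr'.ne', ?_, ?_, ?_⟩
  · field_simp
    ring
  · exact div_nonneg (add_nonneg (Real.rpow_nonneg (by positivity) t) hV) hrr.le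
  · rw [div_le_iff₀ hrr]
    have e : ((Q ^ t + G) / (Q + 2 * L) * ((Q' ^ t + G') / (Q' + 2 * L')) +
        2 * (L / (Q + 2 * L)) * (L' / (Q' + 2 * L'))) * ((Q + 2 * L) * (Q' + 2 * L')) =
        (Q ^ t + G) * (Q' ^ t + G') + 2 * L * L' := by
      field_simp
    rw [e]
    linarith [hsub, hE1]
  · rw [div_le_iff₀ hrr]
    have e : ((Q ^ t + G) / (Q + 2 * L) * ((Q' ^ t + G') / (Q' + 2 * L')) +
        2 * (L / (Q + 2 * L)) * (L' / (Q' + 2 * L')) *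
          Real.exp (-((1 - t) * (Real.log ((Q + 2 * L) * (Q' + 2 * L')) - Λ)))) *
          ((Q + 2 * L) * (Q' + 2 * L')) =
        (Q ^ t + G) * (Q' ^ t + G') +
          2 * L * L' * Real.exp (-((1 - t) * (Real.log ((Q + 2 * L) * (Q' + 2 * L')) - Λ))) := by
      field_simp
    rw [e]
    linarith [hsub, hE2]

/-! ## §2 Base-fed (linear) schedules are blind -/

/-- **LINEAR (BASE-FED) SCHEDULES ARE BLIND NEAR THE TANGENT.**  If every product node has a parent
that is a base with excess at most a third of its leg share (`F_B ≤ 1 − (2/3)λ_B`, a condition on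
`σ = s − 1` ALONE, e.g. `3^s ≤ 4` for Schönhage's `E₃`), then EVERY node passes, `F_j ≤ 1`, at every
`t` whatsoever (`baseFed_step`).  Such schedules exclude no sub-tangent with `σ` below the base threshold
and therefore certify no rate of `e(k) → 0` at all: all certifying power of the toolbox sits in products
of two DEEP (non-base) factors — the structural dichotomy of this leaf. [cite: Schonhage1981, §5]
[cite: CoppersmithWinograd1982] -/
theorem baseFed_blind (lam F : ℕ → ℝ)
    (H : ∀ j, (0 ≤ lam j ∧ lam j ≤ 1 / 3 ∧ 0 ≤ F j ∧ F j ≤ 1 - 2 / 3 * lam j) ∨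
      (∃ a, a < j ∧ ∃ b, (0 ≤ lam b ∧ lam b ≤ 1 / 3 ∧ 0 ≤ F b ∧ F b ≤ 1 - 2 / 3 * lam b) ∧
        lam j = lam a + lam b - 3 * lam a * lam b ∧ 0 ≤ F j ∧
        F j ≤ F a * F b + 2 * lam a * lam b)) :
    ∀ j, 0 ≤ lam j ∧ lam j ≤ 1 / 3 ∧ 0 ≤ F j ∧ F j ≤ 1 := by
  intro j
  induction j using Nat.strong_induction_on with
  | _ j ih => ?_
  rcases H j with ⟨h0, h1, h2, h3⟩ | ⟨a, ha, b, ⟨b0, b1, b2, b3⟩, e1, h2, h3⟩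
  · exact ⟨h0, h1, h2, by linarith [mul_nonneg (by norm_num : (0 : ℝ) ≤ 2 / 3) h0]⟩
  · obtain ⟨a0, a1, -, a3⟩ := ih a ha
    exact ⟨by rw [e1]; exact (lam_step a0 a1 b0 b1).1, by rw [e1]; exact (lam_step a0 a1 b0 b1).2,
      h2, baseFed_step a1 b0 a3 b2 b3 h3⟩

end Summit.MatrixMultiplication.MatrixMultiplication.Theorems.FarEdgeDescentExactDictionary

end
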